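import Summits.ValiantsHypothesis.ValiantsHypothesis.Theses.UlrichPadded
import Summits.ValiantsHypothesis.ValiantsHypothesis.Theorems.UlrichPaddedOrbitCorankTwoPadNonTight
import Summits.ValiantsHypothesis.ValiantsHypothesis.Theorems.UlrichPaddedOrbitCorankTwoBBLimit
import Summits.ValiantsHypothesis.ValiantsHypothesis.Theorems.UlrichPaddedOrbitCorankTwoLevelled
import Summits.ValiantsHypothesis.ValiantsHypothesis.Theorems.UlrichPaddedOrbitCorankTwoGrenetLevelled
import Literature.Computability.AlgebraicComplexity.AlperBogartVelascoProofs

/-!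
# `UlrichPadded.OrbitCorankTwo` (stmt-ValiantsHypothesis-15032) — line `SketchIdeator1`, lead skeleton

Crux: for `n ≥ 3`, every affine determinantal representation `A` (size `m`) of `per_n` is
`GL_m(ℂ[x]) × GL_m(ℂ[x])`-equivalent to an AFFINE representation whose linear part has all
submaximal minors in `(per_n)` (padding order `j ≥ 1`).

Composition (cards `vdk-window-collapse` + `bb-anchor-no-jump`, crux-ideate round 1, ideator 1):

* `orbitCorankTwo_singleOrbit` (stub S1, OPEN in the window `dc ≤ m ≤ n²`; known modulo
  Quillen–Suslin + Bass stable range for `m ≥ n² + 1`): any two square matrices over `ℂ[x]` with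
  determinant `per_n` are equivalent ("Smith normal form `diag(per_n, 1, …, 1)`", orbit form).
* `orbitCorankTwo_padNonTight` (stub S2, provable): from a representation of size `m₀` build a
  NON-TIGHT affine representation of every size `m > m₀` (`A ⊕ 1`, `det (lin A) = 0`).
* `orbitCorankTwo_bbLimit_isAffineDetRepr` (stub S3, provable; card bb-anchor "LimitIsRep"): an
  admissible Białynicki-Birula limit of an affine representation is an affine representation.
* `orbitCorankTwo_levelledCorankTwo` (stub S4 = verbatim body of the route support item
  `LevelledCorankTwo`, stmt-ValiantsHypothesis-15033; paper proof in
  Cruxes/NoTightInfinity/Ideas/homothety-lift-grading.md, Lever (1)–(3)).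
* `orbitCorankTwo_exists_levelled_seven` (stub S6, provable): Grenet's `7 × 7` representation of
  `per₃` is levelled (torus-graded); with `dc(per₃) = 7` (Alper–Bogart–Velasco, PROVED in tree)
  this is the optimal-size anchor at `n = 3`.
* `orbitCorankTwo_nonTightOptimal_four_le` (stub S5, OPEN for `n ≥ 4`: hostage to the unknown
  optimal representations of `per_n`): some optimal-size representation is non-tight — a NECESSARY
  consequence of the crux; sufficient: a levelled / BB-degenerable optimal representation (S3 + S4).

Glue (sorry-free below): minimal size `m⋆ ≤ m`; a non-tight affine `B` of size `m` exists
(`m⋆ < m`: S2; `m⋆ = m`: n = 3: S6 → S4 with dc(per₃) = 7; n ≥ 4: S5); S1 moves `A` to `B`.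
S3 (`orbitCorankTwo_bbLimit_isAffineDetRepr`, landed) is the tool that turns an ADMISSIBLE optimal
representation into a levelled one (`orbitCorankTwo_nonTight_of_admissible` below).
-/

noncomputable section

namespace Summit.ValiantsHypothesis.Theorems

open MvPolynomial Matrix
open Literature.Computability.AlgebraicComplexity
open Summit.ValiantsHypothesis.ValiantsHypothesis.Theses.UlrichPadded

/-! ## Registered stubs still open (S1, S5); S2, S3, S4, S6 are LANDED (imports above) -/

/-- Stub S1 (card vdk-window-collapse, `SingleOrbit` / `SmithNormal` in orbit form, restricted to
affine representations; OPEN in the window `dc(per_n) ≤ m ≤ n²`): for `n ≥ 3` any two affine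
determinantal representations of `per_n` of the same size `m` are `GL_m(ℂ[x])²`-equivalent.
Known for `m ≥ n² + 1` (coker ≅ S_n by factoriality + vzG regularity, Quillen–Suslin, Bass stable
range, `E_m` lifts); sizes `m ≤ 2` never occur (`m ≥ dc(per_n) ≥ n²/2`), so Cohn-type `SL₂`
phenomena are irrelevant. [folklore] -/
theorem orbitCorankTwo_singleOrbit :
    ∀ n : ℕ, 3 ≤ n → ∀ (m : ℕ) (A B : Matrix (Fin m) (Fin m) (MvPolynomial (Fin n × Fin n) ℂ)),
      IsAffineDetRepr (perPoly (Fin n) ℂ) A → IsAffineDetRepr (perPoly (Fin n) ℂ) B →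
      ∃ P Q : Matrix (Fin m) (Fin m) (MvPolynomial (Fin n × Fin n) ℂ),
        IsUnit P ∧ IsUnit Q ∧ P * A * Q = B := by
  sorry

/-- Stub S5 (OPEN for `n ≥ 4`; `NonTightOptimal`, a NECESSARY consequence of the crux at the
minimal size): for `n ≥ 4`, at the minimal representation size `m = dc(per_n)` some affine
representation of `per_n` has all submaximal minors of its linear part in `(per_n)`. (The crux applied to
any optimal representation yields such a `P·A·Q`; conversely this is all the glue needs at `m = dc`.
Sufficient: some optimal representation is levelled — or admits admissible Białynicki-Birula weights,
by `orbitCorankTwo_bbLimit_isAffineDetRepr` + `orbitCorankTwo_levelledCorankTwo`; nothing is known about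
optimal representations of `per_n` for `n ≥ 4`, `dc(per₄) ∈ [9, 15]`.) [folklore] -/
theorem orbitCorankTwo_nonTightOptimal_four_le :
    ∀ n : ℕ, 4 ≤ n → ∀ m : ℕ, HasDetRepr (perPoly (Fin n) ℂ) m →
      (∀ m', m' < m → ¬ HasDetRepr (perPoly (Fin n) ℂ) m') →
      ∃ B : Matrix (Fin m) (Fin m) (MvPolynomial (Fin n × Fin n) ℂ),
        IsAffineDetRepr (perPoly (Fin n) ℂ) B ∧
        ∀ i j, (Matrix.of fun a b => MvPolynomial.homogeneousComponent 1 (B a b)).adjugate i j ∈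
          Ideal.span {perPoly (Fin n) ℂ} := by
  sorry

/-! ## Glue (sorry-free) -/

/-- The Białynicki-Birula limit matrix is levelled with the opposite weights. [folklore] -/
theorem orbitCorankTwo_bbLimit_levelled {n m : ℕ}
    (A : Matrix (Fin m) (Fin m) (MvPolynomial (Fin n × Fin n) ℂ)) (α β : Fin m → ℤ) :
    let B : Matrix (Fin m) (Fin m) (MvPolynomial (Fin n × Fin n) ℂ) := Matrix.of fun i j =>
        (if α i + β j = 0 then MvPolynomial.C (MvPolynomial.constantCoeff (A i j)) else 0) +
        (if α i + β j = -1 then MvPolynomial.homogeneousComponent 1 (A i j) else 0)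
    (∀ i j, MvPolynomial.constantCoeff (B i j) ≠ 0 → (-α) i + (-β) j = 0) ∧
    (∀ i j, MvPolynomial.homogeneousComponent 1 (B i j) ≠ 0 → (-α) i + (-β) j = 1) := by
  intro B
  have hc1 : ∀ i j, MvPolynomial.constantCoeff
      (MvPolynomial.homogeneousComponent 1 (A i j)) = 0 := fun i j => by
    rw [MvPolynomial.constantCoeff_eq, coeff_homogeneousComponent]
    simp
  have hh1 : ∀ c : ℂ, MvPolynomial.homogeneousComponent 1
      (MvPolynomial.C c : MvPolynomial (Fin n × Fin n) ℂ) = 0 := fun c =>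
    homogeneousComponent_eq_zero _ _ (by simp)
  refine ⟨fun i j h => ?_, fun i j h => ?_⟩
  · simp only [B, Matrix.of_apply, map_add, Pi.neg_apply] at h ⊢
    by_contra hne
    apply h
    rw [if_neg (by omega)]
    split_ifs <;> simp [hc1]
  · simp only [B, Matrix.of_apply, map_add, Pi.neg_apply] at h ⊢
    by_contra hne
    apply h
    have h2 : ¬ (α i + β j = -1) := by omega
    rw [if_neg h2]
    split_ifs <;> simp [hh1]

/-- From an ADMISSIBLE affine representation (weights `≥ 0` on the constant support, `≥ −1` on the
linear support, `Σ = −n`) of size `m`, a non-tight affine representation of the same size: its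
Białynicki-Birula anchor (S3, landed) is levelled, hence has `adj (lin) = 0` (S4, landed). [folklore] -/
theorem orbitCorankTwo_nonTight_of_admissible (n : ℕ) (hn : 3 ≤ n) (m : ℕ)
    (A : Matrix (Fin m) (Fin m) (MvPolynomial (Fin n × Fin n) ℂ)) (α β : Fin m → ℤ)
    (hA : IsAffineDetRepr (perPoly (Fin n) ℂ) A)
    (ha0 : ∀ i j, MvPolynomial.constantCoeff (A i j) ≠ 0 → 0 ≤ α i + β j)
    (ha1 : ∀ i j, MvPolynomial.homogeneousComponent 1 (A i j) ≠ 0 → -1 ≤ α i + β j)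
    (hsum : ∑ i, α i + ∑ j, β j = -(n : ℤ)) :
    ∃ B : Matrix (Fin m) (Fin m) (MvPolynomial (Fin n × Fin n) ℂ),
      IsAffineDetRepr (perPoly (Fin n) ℂ) B ∧
      (Matrix.of fun a b => MvPolynomial.homogeneousComponent 1 (B a b)).adjugate = 0 := by
  have hlim := orbitCorankTwo_bbLimit_isAffineDetRepr n m A α β hA ha0 ha1 hsum
  have hlev := orbitCorankTwo_bbLimit_levelled A α β
  exact ⟨_, hlim, orbitCorankTwo_levelledCorankTwo n hn m _ hlim (-α) (-β) hlev.1 hlev.2⟩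

/-- `NonTightAtMinimalSize`: at the minimal representation size there is a non-tight affine
representation (n = 3: Grenet₇ is levelled, S6 + S4, and `dc(per₃) = 7`; n ≥ 4: S5). [folklore] -/
theorem orbitCorankTwo_nonTight_minimal (n : ℕ) (hn : 3 ≤ n) (m : ℕ)
    (hm : HasDetRepr (perPoly (Fin n) ℂ) m)
    (hmin : ∀ m', m' < m → ¬ HasDetRepr (perPoly (Fin n) ℂ) m') :
    ∃ B : Matrix (Fin m) (Fin m) (MvPolynomial (Fin n × Fin n) ℂ),
      IsAffineDetRepr (perPoly (Fin n) ℂ) B ∧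
      ∀ i j, (Matrix.of fun a b => MvPolynomial.homogeneousComponent 1 (B a b)).adjugate i j ∈
        Ideal.span {perPoly (Fin n) ℂ} := by
  rcases Nat.lt_or_ge n 4 with h3 | h4
  · -- `n = 3`: the minimal size is `dc(per₃) = 7` (Alper–Bogart–Velasco, proved in tree)
    obtain rfl : n = 3 := by omega
    have hdc : determinantalComplexity (perPoly (Fin 3) ℂ) = 7 :=
      (alperBogartVelasco2017_cor_1_4_complex alperBogartVelasco2017_cor_1_4_holds).1
    have hle : determinantalComplexity (perPoly (Fin 3) ℂ) ≤ m :=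
      determinantalComplexity_le_of_hasDetRepr hm
    have h7 : HasDetRepr (perPoly (Fin 3) ℂ) 7 := by
      have h := Nat.sInf_mem (s := {k : ℕ | HasDetRepr (perPoly (Fin 3) ℂ) k}) ⟨m, hm⟩
      have h' : sInf {k : ℕ | HasDetRepr (perPoly (Fin 3) ℂ) k} = 7 := hdc
      rw [h'] at h
      exact h
    have hm7 : m = 7 := by
      have hge : ¬ 7 < m := fun hlt => hmin 7 hlt h7
      omega
    subst hm7
    obtain ⟨A, α, β, hA, h0, h1⟩ := orbitCorankTwo_exists_levelled_seven
    refine ⟨A, hA, fun i j => ?_⟩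
    rw [orbitCorankTwo_levelledCorankTwo 3 le_rfl 7 A hA α β h0 h1]
    exact Ideal.zero_mem _
  · -- `n ≥ 4`: the open stub S5
    exact orbitCorankTwo_nonTightOptimal_four_le n h4 m hm hmin

/-- **Composition**: the stubs S1–S6 imply the crux `OrbitCorankTwo` by name. [folklore] -/
theorem OrbitCorankTwo_of : OrbitCorankTwo := by
  intro n hn m A hA
  -- the minimal representation size `m⋆ ≤ m`
  set S : Set ℕ := {k | HasDetRepr (perPoly (Fin n) ℂ) k} with hS
  have hmS : m ∈ S := ⟨A, hA⟩
  have hstar : sInf S ∈ S := Nat.sInf_mem ⟨m, hmS⟩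
  have hle : sInf S ≤ m := Nat.sInf_le hmS
  have hmin : ∀ m', m' < sInf S → ¬ HasDetRepr (perPoly (Fin n) ℂ) m' :=
    fun m' hlt hm' => Nat.notMem_of_lt_sInf hlt hm'
  -- a non-tight affine representation `B` of size `m`
  obtain ⟨B, hB, hBadj⟩ : ∃ B : Matrix (Fin m) (Fin m) (MvPolynomial (Fin n × Fin n) ℂ),
      IsAffineDetRepr (perPoly (Fin n) ℂ) B ∧
      ∀ i j, (Matrix.of fun a b => MvPolynomial.homogeneousComponent 1 (B a b)).adjugate i j ∈
        Ideal.span {perPoly (Fin n) ℂ} := by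
    rcases Nat.lt_or_ge (sInf S) m with hlt | hge
    · obtain ⟨A₀, hA₀⟩ := hstar
      exact orbitCorankTwo_padNonTight n hn (sInf S) A₀ hA₀ m hlt
    · have heq : sInf S = m := le_antisymm hle hge
      exact orbitCorankTwo_nonTight_minimal n hn m hmS (heq ▸ hmin)
  -- move `A` to `B` inside its gauge orbit (S1)
  obtain ⟨P, Q, hP, hQ, hPAQ⟩ := orbitCorankTwo_singleOrbit n hn m A B hA hB
  refine ⟨P, Q, hP, hQ, ?_, ?_⟩
  · rw [hPAQ]; exact hB
  · rw [hPAQ]; exact hBadj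

end Summit.ValiantsHypothesis.Theorems
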